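import Summits.MatrixMultiplication.MatrixMultiplication.Theorems.SaturationLadderLevelTwoK6Word
import Literature.Computability.AlgebraicComplexity.RectangularExponentAlpha
import HarnessLib

/-!
# Level 2 of the saturation ladder at `ω(1,6,1)`: `ω(1,6,1) ≤ 229/32 = 7.15625`
# (route `SaturationLadder`, node `TailDescentTwo`, lens 1 «grading / quantitative ladder», gen 22)

Cell `decomp-mm`, lens 1, gen 22 — fifth rung of the level-2 DEFECT LADDER
`δ_k = ω(1,k,1) − (k+1)` in proved currency (`δ₂ ≤ 0.2581`, `δ₃ ≤ 0.2106`, `δ₄ ≤ 0.1861`,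
`δ₅ ≤ 0.1693` in `SaturationLadderLevelTwoK2/3/4/5`): **`ω(1,6,1) ≤ 229/32`**, i.e.
`δ₆ ≤ 5/32 = 0.15625` (`omegaRect_one_six_one_le_229_32`), beating descent from the `k = 5` rung
(`401/65 + 1 = 7.1692`), and the tail `ω(1,k,1) ≤ k + 37/32` for every real `k ≥ 6`
(`omegaRect_one_mid_one_le_add_of_six`).  No named facts, no sorry, no definitions (design and law
in `SaturationLadderLevelTwoK6Word`, `q = 9` block lemmas and the packing bound
`R̃(CW_9^{⊗2}) ≤ 121` in `SaturationLadderLevelTwoKit9`).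

THE PROOF.  `laserMethod_hasFormatValue_of_wordValue` on the valued word `lvl2Word` (`d = 2176`,
`q = 9`, `87` copies of the `3 : 3 : 2` family block at `σ = 19/20`, NO letter `400`); the law is of
product form on the used support with empty row `I = 4`, so the penalty is `0` (zero-row lemma);
marginals `x : (1392, 534, 246, 4, 0)/2176`, `y = z : (47, 563, 1431, 132, 3)/2176`, `H_y ≤ H_x`
(`cert_marginals`); formats `A⁶ ≤ B` by `cert_format : 9^21141 ≤ 18^2040 · 83^9180`; packing
`2^{H_y} W A^{ω(1,6,1)} ≤ 121` and the final integer certificate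
`cert_final : 11^143488 · 47^1504 · 53^45792 · 563^18016 ≤ 2^497512 · 3^61198 · 17^69632 · 83^8244`
(prime logarithms `ln 2176 = 7 ln 2 + ln 17`, `ln 1431 = 3 ln 3 + ln 53`,
`ln 132 = 2 ln 2 + ln 3 + ln 11`, `ln 18`, `ln 9`, `ln 121`).  WHY `q = 9`: under the cap `A^6 ≤ B`
the real optimum of the kernel is `7.1568 (q = 8)`, `7.15424 (q = 9)`, `7.1562 (q = 10)` — numerics
gen22/design332.py, intsearch332.py, certs_gen.py: integer design `7.1555537`,
`ln B / ln A = 6.00086`, slack to `229/32`: `7.0e-4`, log-margin of `cert_final`: `25.4`.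
All certificates are `decide`d integer inequalities (kernel; `exponentiation.threshold 10⁶`).

## References

* F. Le Gall, *Faster algorithms for rectangular matrix multiplication*, FOCS 2012,
  arXiv:1204.1111, §3, §6.1, Prop. 6.2, Table 2. [LeGall2012]
* D. Coppersmith, S. Winograd, *Matrix multiplication via arithmetic progressions*,
  J. Symbolic Comput. 9 (1990), §8. [CoppersmithWinograd1990]
* D. Coppersmith, *Rectangular matrix multiplication revisited*, J. Complexity 13 (1997), §3.
  [Coppersmith1997]
* F. Le Gall, *Powers of tensors and fast matrix multiplication*, ISSAC 2014, arXiv:1401.7714,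
  Thm. 4.1 and Appendix A.3. [LeGall2014]
* F. Le Gall, F. Urrutia, *Improved rectangular matrix multiplication using powers of the
  Coppersmith–Winograd tensor*, SODA 2018, arXiv:1708.05622, Table 3. [LeGallUrrutia2018]
-/

set_option linter.dupNamespace false
set_option autoImplicit false
set_option exponentiation.threshold 1000000
set_option maxRecDepth 100000

noncomputable section

open Finset Real
open scoped BigOperators

namespace Summit.MatrixMultiplication.MatrixMultiplication.Theorems.SaturationLadderLevelTwoK6

open Literature.Computability.AlgebraicComplexity
open SaturationLadderLevelTwoKit (PL5 supp14)
open SaturationLadderLevelTwoKit9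
open SaturationLadderLevelTwo (append_mem repWord_mem const_mem fin5_lits negMulLog_div'
  log_two_mul_shannonEntropy_fin5)

/-! ## Marginal entropies -/

/-- **`ln 2 · H_x = ln 2176 − (1392 ln 1392 + 534 ln 534 + 246 ln 246 + 4 ln 4)/2176`.**
[folklore] -/
theorem entropy₁_lvl2Law : Real.log 2 * shannonEntropy (marginalDist₁ lvl2Law) =
    Real.log 2176 - (1392 * Real.log 1392 + 534 * Real.log 534 + 246 * Real.log 246 +
      4 * Real.log 4) / 2176 := by
  obtain ⟨e0, e1, e2, e3, e4⟩ := marginalDist₁_lvl2Law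
  rw [log_two_mul_shannonEntropy_fin5, e0, e1, e2, e3, e4,
    negMulLog_div' (by norm_num) (by norm_num), negMulLog_div' (by norm_num) (by norm_num),
    negMulLog_div' (by norm_num) (by norm_num), negMulLog_div' (by norm_num) (by norm_num),
    Real.negMulLog_zero]
  ring

/-- **`ln 2 · H_y = ln 2176 − (47 ln 47 + 563 ln 563 + 1431 ln 1431 + 132 ln 132 + 3 ln 3)/2176`.**
[folklore] -/
theorem entropy₂_lvl2Law : Real.log 2 * shannonEntropy (marginalDist₂ lvl2Law) =
    Real.log 2176 - (47 * Real.log 47 + 563 * Real.log 563 + 1431 * Real.log 1431 +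
      132 * Real.log 132 + 3 * Real.log 3) / 2176 := by
  obtain ⟨e0, e1, e2, e3, e4⟩ := marginalDist₂_lvl2Law
  rw [log_two_mul_shannonEntropy_fin5, e0, e1, e2, e3, e4,
    negMulLog_div' (by norm_num) (by norm_num), negMulLog_div' (by norm_num) (by norm_num),
    negMulLog_div' (by norm_num) (by norm_num), negMulLog_div' (by norm_num) (by norm_num),
    negMulLog_div' (by norm_num) (by norm_num)]
  ring

/-- `ln 2 · H_z = ln 2 · H_y`. [folklore] -/
theorem entropy₃_lvl2Law : Real.log 2 * shannonEntropy (marginalDist₃ lvl2Law) =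
    Real.log 2176 - (47 * Real.log 47 + 563 * Real.log 563 + 1431 * Real.log 1431 +
      132 * Real.log 132 + 3 * Real.log 3) / 2176 := by
  obtain ⟨e0, e1, e2, e3, e4⟩ := marginalDist₃_lvl2Law
  rw [log_two_mul_shannonEntropy_fin5, e0, e1, e2, e3, e4,
    negMulLog_div' (by norm_num) (by norm_num), negMulLog_div' (by norm_num) (by norm_num),
    negMulLog_div' (by norm_num) (by norm_num), negMulLog_div' (by norm_num) (by norm_num),
    negMulLog_div' (by norm_num) (by norm_num)]
  ring

/-- Integer certificate: `∏ u_x^{u_x} ≤ ∏ u_y^{u_y}` (`H_y ≤ H_x`). [folklore] -/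
theorem cert_marginals :
    (1392 : ℕ) ^ 1392 * 534 ^ 534 * 246 ^ 246 * 4 ^ 4 ≤
      47 ^ 47 * 563 ^ 563 * 1431 ^ 1431 * 132 ^ 132 * 3 ^ 3 := by
  decide

/-! ## The certificates and the conclusion -/

/-- Integer certificate: `9^21141 ≤ 18^2040 · 83^9180` (`A⁶ ≤ B` for the per-position formats).
[folklore] -/
theorem cert_format : (9 : ℕ) ^ 21141 ≤ 18 ^ 2040 * 83 ^ 9180 := by
  decide

/-- Integer certificate of the final inequality `32 (ln 121 − H_y ln 2 − ln W) ≤ 229 ln A`: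
`11^143488 · 47^1504 · 53^45792 · 563^18016 ≤ 2^497512 · 3^61198 · 17^69632 · 83^8244`.
[folklore] -/
theorem cert_final :
    (11 : ℕ) ^ 143488 * 47 ^ 1504 * 53 ^ 45792 * 563 ^ 18016 ≤
      2 ^ 497512 * 3 ^ 61198 * 17 ^ 69632 * 83 ^ 8244 := by
  decide

/-- **Level 2 of the saturation ladder at `ω(1,6,1)` (the `k = 6` instance of the hypothesis of the
node `TailDescentTwo`): `ω(1,6,1) ≤ 229/32`** (Le Gall 2012 §6 at `q = 9` in the tree's currency,
with the `3 : 3 : 2` family block at `σ = 19/20` and the explicit design `lvl2Word`).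
[cite: LeGall2012, §6.1, Prop. 6.2 and Table 2] [cite: CoppersmithWinograd1990, §8]
[cite: Coppersmith1997, §3] -/
theorem omegaRect_one_six_one_le_229_32 : omegaRect ℂ 1 6 1 ≤ 229 / 32 := by
  -- the minimum marginal entropy is `H_y` (folded in: `H_y ≤ H_x`, `H_z = H_y`)
  have entropy₂_le_entropy₁ :
      shannonEntropy (marginalDist₂ lvl2Law) ≤ shannonEntropy (marginalDist₁ lvl2Law) := by
    have hlog : 0 < Real.log 2 := Real.log_pos one_lt_two
    have h : ((1392 : ℕ) ^ 1392 * 534 ^ 534 * 246 ^ 246 * 4 ^ 4 : ℝ) ≤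
        (47 : ℕ) ^ 47 * 563 ^ 563 * 1431 ^ 1431 * 132 ^ 132 * 3 ^ 3 := by
      exact_mod_cast cert_marginals
    push_cast at h
    have h' := Real.log_le_log (by positivity) h
    rw [Real.log_mul (by positivity) (by positivity), Real.log_mul (by positivity) (by positivity),
      Real.log_mul (by positivity) (by positivity), Real.log_mul (by positivity) (by positivity),
      Real.log_mul (by positivity) (by positivity), Real.log_mul (by positivity) (by positivity),
      Real.log_mul (by positivity) (by positivity)] at h'
    simp only [Real.log_pow, Nat.cast_ofNat] at h'
    have e1 := entropy₁_lvl2Law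
    have e2 := entropy₂_lvl2Law
    have key : Real.log 2 * shannonEntropy (marginalDist₂ lvl2Law) ≤
        Real.log 2 * shannonEntropy (marginalDist₁ lvl2Law) := by
      rw [e1, e2]
      linarith [h']
    exact le_of_mul_le_mul_left key hlog
  have entropy₃_eq_entropy₂ :
      shannonEntropy (marginalDist₃ lvl2Law) = shannonEntropy (marginalDist₂ lvl2Law) := by
    have hlog : Real.log 2 ≠ 0 := (Real.log_pos one_lt_two).ne'
    have e := entropy₃_lvl2Law
    rw [← entropy₂_lvl2Law] at e
    exact mul_left_cancel₀ hlog e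
  have min_entropy_lvl2Law :
      min (shannonEntropy (marginalDist₁ lvl2Law)) (min (shannonEntropy (marginalDist₂ lvl2Law))
        (shannonEntropy (marginalDist₃ lvl2Law))) = shannonEntropy (marginalDist₂ lvl2Law) := by
    rw [entropy₃_eq_entropy₂, min_self]
    exact min_eq_right entropy₂_le_entropy₁
  -- per-position value and formats: the `2176`-th roots of the totals
  set W : ℝ := Vtot ^ (((2176 : ℕ) : ℝ)⁻¹) with hWdef
  set A : ℝ := Xtot ^ (((2176 : ℕ) : ℝ)⁻¹) with hAdef
  set B : ℝ := Ytot ^ (((2176 : ℕ) : ℝ)⁻¹) with hBdef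
  have hW0 : 0 < W := Real.rpow_pos_of_pos Vtot_pos _
  have hA0 : 0 < A := Real.rpow_pos_of_pos Xtot_pos _
  have hB0 : 0 < B := Real.rpow_pos_of_pos Ytot_pos _
  have hWd : W ^ 2176 = Vtot := Real.rpow_inv_natCast_pow Vtot_pos.le (by norm_num)
  have hAd : A ^ 2176 = Xtot := Real.rpow_inv_natCast_pow Xtot_pos.le (by norm_num)
  have hBd : B ^ 2176 = Ytot := Real.rpow_inv_natCast_pow Ytot_pos.le (by norm_num)
  have hblk : HasFormatValue (blockOf9 lvl2Word) (W ^ 2176) (A ^ 2176) (B ^ 2176) (A ^ 2176) := by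
    rw [hWd, hAd, hBd]; exact hasFormatValue_lvl2Word
  -- the laser method on the valued word
  have hT := laserMethod_hasFormatValue_of_wordValue (bigCwSq ℂ 9) cwLev2 cwLev2 cwLev2
    cwSupport₂ (bigCwSq_cwSupport₂ ℂ 9) cwTight₂ cwTight₂ cwTight₂γ cwTight₂_injective
    cwTight₂_injective cwTight₂γ_injective cwTight₂_bound cwTight₂_bound cwTight₂_sum
    (by norm_num : 0 < 2176) lvl2Word lvl2Word_mem lvl2Law lvl2Law_eq hW0 hA0.le hB0.le hA0.le
    hblk
  rw [maxEntropyPenalty_lvl2Law, sub_zero, min_entropy_lvl2Law] at hT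
  -- logarithms of the roots
  have hlogW : Real.log W = (2176 : ℝ)⁻¹ * (87 * (6 * Real.log 2)) := by
    rw [hWdef, Real.log_rpow Vtot_pos, Vtot, one_mul, Real.log_pow,
      Real.log_rpow (by norm_num : (0 : ℝ) < 2)]
    push_cast; ring
  have hlogA : Real.log A = (2176 : ℝ)⁻¹ *
      (8 * Real.log 18 + 36 * Real.log 83 + 87 * (5 * Real.log 9)) := by
    rw [hAdef, Real.log_rpow Xtot_pos, Xtot, Real.log_mul (by positivity) (by positivity),
      Real.log_mul (by positivity) (by positivity), Real.log_pow, Real.log_pow, Real.log_pow,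
      Real.log_rpow (by norm_num : (0 : ℝ) < 9)]
    push_cast; ring
  have hlogB : Real.log B = (2176 : ℝ)⁻¹ *
      (252 * Real.log 18 + 1134 * Real.log 83 + 87 * (57 / 10 * Real.log 9)) := by
    rw [hBdef, Real.log_rpow Ytot_pos, Ytot, Real.log_mul (by positivity) (by positivity),
      Real.log_mul (by positivity) (by positivity), Real.log_pow, Real.log_pow, Real.log_pow,
      Real.log_rpow (by norm_num : (0 : ℝ) < 9)]
    push_cast; ring
  have l18 : Real.log 18 = Real.log 2 + 2 * Real.log 3 := by
    rw [show (18 : ℝ) = 2 * 3 ^ 2 by norm_num, Real.log_mul (by norm_num) (by norm_num),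
      Real.log_pow]; push_cast; ring
  have l9 : Real.log 9 = 2 * Real.log 3 := by
    rw [show (9 : ℝ) = 3 ^ 2 by norm_num, Real.log_pow]; push_cast; ring
  have l121 : Real.log 121 = 2 * Real.log 11 := by
    rw [show (121 : ℝ) = 11 ^ 2 by norm_num, Real.log_pow]; push_cast; ring
  have l2176 : Real.log 2176 = 7 * Real.log 2 + Real.log 17 := by
    rw [show (2176 : ℝ) = 2 ^ 7 * 17 by norm_num, Real.log_mul (by norm_num) (by norm_num),
      Real.log_pow]; push_cast; ring
  have l1431 : Real.log 1431 = 3 * Real.log 3 + Real.log 53 := by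
    rw [show (1431 : ℝ) = 3 ^ 3 * 53 by norm_num, Real.log_mul (by norm_num) (by norm_num),
      Real.log_pow]; push_cast; ring
  have l132 : Real.log 132 = 2 * Real.log 2 + Real.log 3 + Real.log 11 := by
    rw [show (132 : ℝ) = 2 ^ 2 * 3 * 11 by norm_num, Real.log_mul (by norm_num) (by norm_num),
      Real.log_mul (by norm_num) (by norm_num), Real.log_pow]; push_cast; ring
  -- (1) `A > 1`
  have hX1 : 1 < Xtot := by
    unfold Xtot
    have h1 : (1 : ℝ) < 18 ^ 8 * 83 ^ 36 := by norm_num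
    have h2 : (1 : ℝ) ≤ ((9 : ℝ) ^ (5 : ℝ)) ^ 87 :=
      one_le_pow₀ (Real.one_le_rpow (by norm_num) (by norm_num))
    exact one_lt_mul_of_lt_of_le h1 h2
  have hA1 : 1 < A := Real.one_lt_rpow hX1 (by positivity)
  have hlA : 0 < Real.log A := Real.log_pos hA1
  -- (2) the format inequality `A⁶ ≤ B`
  have hAB : A ^ (6 : ℝ) ≤ B := by
    rw [← Real.log_le_log_iff (Real.rpow_pos_of_pos hA0 _) hB0, Real.log_rpow hA0, hlogA, hlogB]
    have hc : ((9 : ℕ) ^ 21141 : ℝ) ≤ (18 : ℕ) ^ 2040 * (83 : ℕ) ^ 9180 := by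
      exact_mod_cast cert_format
    push_cast at hc
    have hc' := Real.log_le_log (by positivity) hc
    rw [Real.log_mul (by positivity) (by positivity)] at hc'
    simp only [Real.log_pow, Nat.cast_ofNat] at hc'
    linarith
  -- (3) the packing bound `2^{H_y} W A^{ω(1,6,1)} ≤ R̃(CW_9^{⊗2}) ≤ 121`, in logarithms
  have hmain := mul_rpow_omegaRect_le_asymptoticRank_of_hasFormatValue hT hA1 (by norm_num) hAB
  have h121 := hmain.trans asymptoticRank_bigCwSq_nine_le
  have hpos : 0 < (2 : ℝ) ^ shannonEntropy (marginalDist₂ lvl2Law) * W * A ^ omegaRect ℂ 1 6 1 := by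
    positivity
  have hlog := Real.log_le_log hpos h121
  rw [Real.log_mul (by positivity) (by positivity), Real.log_mul (by positivity) (by positivity),
    Real.log_rpow (by norm_num : (0 : ℝ) < 2), Real.log_rpow hA0] at hlog
  -- (4) the final certificate: `ln 121 − H_y ln 2 − ln W ≤ (229/32) ln A`
  have e2 := entropy₂_lvl2Law
  rw [l2176, l1431, l132] at e2
  have hc : ((11 : ℕ) ^ 143488 * (47 : ℕ) ^ 1504 * (53 : ℕ) ^ 45792 * (563 : ℕ) ^ 18016 : ℝ) ≤
      (2 : ℕ) ^ 497512 * (3 : ℕ) ^ 61198 * (17 : ℕ) ^ 69632 * (83 : ℕ) ^ 8244 := by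
    exact_mod_cast cert_final
  push_cast at hc
  have hc' := Real.log_le_log (by positivity) hc
  rw [Real.log_mul (by positivity) (by positivity), Real.log_mul (by positivity) (by positivity),
    Real.log_mul (by positivity) (by positivity), Real.log_mul (by positivity) (by positivity),
    Real.log_mul (by positivity) (by positivity), Real.log_mul (by positivity) (by positivity)]
    at hc'
  simp only [Real.log_pow, Nat.cast_ofNat] at hc'
  have hfin : Real.log 121 - shannonEntropy (marginalDist₂ lvl2Law) * Real.log 2 - Real.log W ≤
      229 / 32 * Real.log A := by
    rw [hlogW, hlogA, l121, l18, l9]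
    linarith
  have key : omegaRect ℂ 1 6 1 * Real.log A ≤ 229 / 32 * Real.log A := by linarith
  exact le_of_mul_le_mul_right key hlA

/-- **`ω(1,6,1) < 7.1563`.** [cite: LeGall2012, §6.1] -/
theorem omegaRect_one_six_one_lt_7_1563 : omegaRect ℂ 1 6 1 < 7.1563 :=
  lt_of_le_of_lt omegaRect_one_six_one_le_229_32 (by norm_num)

/-- **The `k = 6` rung beats descent from the `k = 5` rung** (`401/65 + 1 = 466/65 = 7.1692…`,
`SaturationLadderLevelTwoK5.omegaRect_one_mid_one_le_add_of_five`). [cite: LeGall2012, §6.1] -/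
theorem omegaRect_one_six_one_lt_descent : omegaRect ℂ 1 6 1 < 466 / 65 :=
  lt_of_le_of_lt omegaRect_one_six_one_le_229_32 (by norm_num)

/-- The remaining gap of the rung to `ω(1,6,1) = 7` (the `k = 6` instance of the hypothesis of
`TailDescentTwo`) is `< 0.1563`: the level-2 defect ladder reads `0.2581 (k=2) > 0.2106 (k=3) >
0.1861 (k=4) > 0.1693 (k=5) > 0.1563 (k=6)`. [cite: LeGall2012, §6.1] -/
theorem omegaRect_one_six_one_sub_seven_lt : omegaRect ℂ 1 6 1 - 7 < 0.1563 := by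
  have := omegaRect_one_six_one_le_229_32; norm_num at this ⊢; linarith

/-- **Descent to the tail**: `ω(1,k,1) ≤ k + 37/32` for every real `k ≥ 6`
(`omegaRect_one_mid_one_le_add`). [cite: Coppersmith1997, §3] -/
theorem omegaRect_one_mid_one_le_add_of_six (k : ℝ) (hk : 6 ≤ k) :
    omegaRect ℂ 1 k 1 ≤ k + 37 / 32 := by
  have h := omegaRect_one_mid_one_le_add (K := ℂ) hk
  have h6 := omegaRect_one_six_one_le_229_32
  norm_num at h h6 ⊢
  linarith

end Summit.MatrixMultiplication.MatrixMultiplication.Theorems.SaturationLadderLevelTwoK6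

end
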